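import Literature.Probability.Percolation.GluingAssembly
import Literature.Probability.Percolation.StoppingSetCondExp
import HarnessLib

/-!
# The coarse-grained surrogate from the exact structure of the crossing event

Topic `Probability/Percolation`.  Support file (proofs, no named fact) for the named fact
`SchrammSmirnov2011_thm_1_7` (`QuadCrossingNoise.lean`), refining the hypothesis package
`GluingSurrogateAt` of `GluingAssembly.lean` (SS11 §4, proof of Prop. 4.1, (4.6) and "Ỹ_T is a
function of the triple (Z_c, Z_o, G)"): if, on a data event `A` (of small complement) of the
stopping `σ`-field, the modified crossing event `E'` of the glued configuration is EXACTLY a fixed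
boolean function `Φ` of explored data `d(ω)` and finitely many fresh bits `b_i` (the structure
theorem, `PortLink.mem_z2QuadConfig_iff_portChain`), if the bits `b_i` differ from coarse bits
`b^T_i` with small total probability (Lemma 6.1, (eGG)), and if the law of the coarse bits and the
data are read off the crossing bits of a finite family `F` of quads (step (A)), then
`Z(ω) := P_ζ(Φ(d(ω), b^T(ω ⊕ ζ)))` is a surrogate: `‖Z − Ỹ‖₂² ≤ ε₂² + ε₃`
(`gluingSurrogateAt_of_structure`).

## References

* O. Schramm, S. Smirnov, *On the scaling limits of planar percolation*, Ann. Probab. 39 (2011)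
  1768–1814, arXiv:1101.5820, §4, proof of Prop. 4.1 ((eGG), (4.6), "Final estimates").
  [SchrammSmirnov2011]
-/

noncomputable section

open Set Metric MeasureTheory Filter Topology
open scoped symmDiff ENNReal
open Literature.Probability.LatticeModels

namespace Literature.Probability.Percolation

namespace QuadCrossing

variable {D : Set ℂ}

/-! ### Measurability of functions of finitely many bits -/

/-- **A set described by finitely many measurable bits is measurable.** [folklore] -/
theorem measurableSet_setOf_bits {Ω ι : Type*} [MeasurableSpace Ω] [Fintype ι] (b : Ω → ι → Prop)
    (hb : ∀ i, MeasurableSet {ζ | b ζ i}) (Ψ : (ι → Prop) → Prop) : MeasurableSet {ζ | Ψ (b ζ)} := by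
  classical
  -- decompose along the finitely many boolean patterns
  have : {ζ | Ψ (b ζ)} = ⋃ v ∈ (Finset.univ : Finset (ι → Bool)).filter (fun v => Ψ (fun i => v i = true)),
      ⋂ i, {ζ | b ζ i ↔ v i = true} := by
    ext ζ
    simp only [mem_setOf_eq, mem_iUnion, mem_iInter, Finset.mem_filter, Finset.mem_univ, true_and, exists_prop]
    constructor
    · intro h
      refine ⟨fun i => decide (b ζ i), ?_, fun i => by simp⟩
      have : (fun i => decide (b ζ i) = true) = b ζ := funext fun i => by simp
      rwa [this]
    · rintro ⟨v, hv, hiff⟩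
      have : b ζ = fun i => v i = true := funext fun i => propext (hiff i)
      rwa [this]
  rw [this]
  refine Finset.measurableSet_biUnion _ fun v _ => MeasurableSet.iInter fun i => ?_
  by_cases hvi : v i = true
  · simp only [hvi, iff_true]; exact hb i
  · have : {ζ | b ζ i ↔ v i = true} = {ζ | b ζ i}ᶜ := by
      ext ζ; simp [hvi]
    rw [this]; exact (hb i).compl

/-- **A function of finitely many measurable bits is measurable** (finite-valued). [folklore] -/
theorem measurable_comp_bits {Ω X : Type*} [MeasurableSpace Ω] (f : Ω → Set X) {F : Set X} (hF : F.Finite)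
    (hfF : ∀ ω, f ω ⊆ F) (hf : ∀ Q ∈ F, MeasurableSet {ω | Q ∈ f ω}) (g : Set X → ℝ) :
    Measurable fun ω => g (f ω) := by
  classical
  -- `g ∘ f` is a finite sum of indicators of the level sets of `f`
  have hlevel : ∀ S : Set X, MeasurableSet {ω | f ω = S} := by
    intro S
    by_cases hS : S ⊆ F
    · have : {ω | f ω = S} = (⋂ Q ∈ hF.toFinset.filter (· ∈ S), {ω | Q ∈ f ω}) ∩
          ⋂ Q ∈ hF.toFinset.filter (· ∉ S), {ω | Q ∈ f ω}ᶜ := by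
        ext ω
        simp only [mem_setOf_eq, mem_inter_iff, mem_iInter, Finset.mem_filter, Set.Finite.mem_toFinset, mem_compl_iff]
        constructor
        · intro h
          rw [← h]
          exact ⟨fun Q h' => h'.2, fun Q h' hQ => h'.2 hQ⟩
        · rintro ⟨h1, h2⟩
          ext Q
          constructor
          · intro hQ
            by_contra hQS
            exact h2 Q ⟨hfF ω hQ, hQS⟩ hQ
          · intro hQS
            exact h1 Q ⟨hS hQS, hQS⟩
      rw [this]
      refine MeasurableSet.inter (Finset.measurableSet_biInter _ fun Q hQ => ?_) (Finset.measurableSet_biInter _ fun Q hQ => ?_)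
      · exact hf Q ((Set.Finite.mem_toFinset _).1 (Finset.mem_filter.1 hQ).1)
      · exact (hf Q ((Set.Finite.mem_toFinset _).1 (Finset.mem_filter.1 hQ).1)).compl
    · have : {ω | f ω = S} = ∅ := by
        ext ω
        simp only [mem_setOf_eq, mem_empty_iff_false, iff_false]
        intro h
        exact hS (h ▸ hfF ω)
      rw [this]; exact MeasurableSet.empty
  have heq : (fun ω => g (f ω)) = fun ω => ∑ S ∈ hF.toFinset.powerset.image (fun T : Finset X => (↑T : Set X)),
      {ω | f ω = S}.indicator (fun _ => g S) ω := by
    funext ω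
    rw [Finset.sum_eq_single (f ω)]
    · simp
    · intro S _ hS
      rw [indicator_of_notMem]; exact fun h => hS (Eq.symm h)
    · intro hnot
      exfalso
      refine hnot (Finset.mem_image.2 ⟨(hF.subset (hfF ω)).toFinset, ?_, by simp⟩)
      rw [Finset.mem_powerset]
      intro Q hQ
      rw [Set.Finite.mem_toFinset] at hQ ⊢
      exact hfF ω hQ
  rw [heq]
  refine Finset.measurable_sum _ fun S _ => ?_
  exact (measurable_const.indicator (hlevel S))

/-! ### The surrogate from the exact structure -/

/-- The configuration glued from `ω` on the explored data and `ζ` on the unexplored block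
`G₀ ∖ N(ω)` (`ω₂` of SS11 p. 18). [cite: SchrammSmirnov2011, §4, proof of Prop. 4.1 (p. 18, ω₂)] -/
def glueAt (G₀ : Finset (Sym2 (Site 2))) (N : BondConfig (Site 2) → Finset (Sym2 (Site 2)))
    (ω ζ : BondConfig (Site 2)) : BondConfig (Site 2) :=
  ω \ ↑(G₀ \ N ω) ∪ ↑(obs ζ (G₀ \ N ω))

/-- `|P(S) − P(T)| ≤ P(S Δ T)` for a finite measure. [folklore] -/
theorem abs_measureReal_sub_le_symmDiff {Ω : Type*} [MeasurableSpace Ω] (P : Measure Ω) [IsFiniteMeasure P]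
    (S T : Set Ω) : |P.real S - P.real T| ≤ P.real (S ∆ T) := by
  rw [abs_sub_le_iff]
  constructor
  · have h1 : P.real S ≤ P.real (T ∪ S ∆ T) := measureReal_mono (fun x hx => by
      by_cases hxT : x ∈ T
      · exact Or.inl hxT
      · exact Or.inr (Or.inl ⟨hx, hxT⟩))
    have h2 := measureReal_union_le (μ := P) T (S ∆ T)
    linarith
  · have h1 : P.real T ≤ P.real (S ∪ S ∆ T) := measureReal_mono (fun x hx => by
      by_cases hxS : x ∈ S
      · exact Or.inl hxS
      · exact Or.inr (Or.inr ⟨hx, hxS⟩))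
    have h2 := measureReal_union_le (μ := P) S (S ∆ T)
    linarith

/-- **The surrogate from the exact structure of the modified crossing event** (SS11 §4, (eGG) and
(4.6)).  Data: a stopping set `N ⊆ G₀` with unexplored edges near the cut, the modified event `E'`
with `P(E Δ E') ≤ ε₁`; a data event `A` of the stopping `σ`-field with `P(Aᶜ) ≤ ε₃`; explored data
`d` (constant on configurations agreeing on the explored edges); a boolean structure function `Φ`
with `ω ⊕ ζ ∈ E' ↔ Φ(d ω, b(ω ⊕ ζ))` for `ω ∈ A` (exact structure); coarse bits `b^T` with
`Σ_i P_ζ(b_i ≠ b^T_i) ≤ ε₂` for `ω ∈ A` (perturbation); and the coarse probability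
`P_ζ(Φ(d ω, b^T(ω ⊕ ζ)))` read off the crossing bits of `F` for `ω ∈ A` (coarse measurability).
Then the surrogate exists at this mesh with accuracy `max ε₁ (ε₂² + ε₃)`.
[cite: SchrammSmirnov2011, §4, proof of Prop. 4.1 ((eGG), "Ỹ_T is a function of (Z_c, Z_o, G)", (4.6))] -/
theorem gluingSurrogateAt_of_structure {α : Set ℂ} {Q₀ : Quad D} {F : Set (Quad D)} (hF : F.Finite) {s δ ε₁ ε₂ ε₃ : ℝ}
    (hδ : 0 < δ)
    {G₀ : Finset (Sym2 (Site 2))} {N : BondConfig (Site 2) → Finset (Sym2 (Site 2))} {E' : Set (BondConfig (Site 2))}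
    (hN : IsStoppingSet N) (hNG : ∀ ω, N ω ⊆ G₀) (hcut : ∀ ω, ∀ e ∈ G₀ \ N ω, e ∈ cutEdges α s δ)
    (hE' : MeasurableSet E')
    (h44 : (bondPercolation (zdGraph 2) half).real ((z2QuadConfig D δ ⁻¹' QuadConfig.crossedEvent Q₀) ∆ E') ≤ ε₁)
    {σ ι : Type*} [Fintype ι] (d : BondConfig (Site 2) → σ) (b bT : BondConfig (Site 2) → ι → Prop)
    (Φ : σ → (ι → Prop) → Prop) {A : Set (BondConfig (Site 2))}
    (hA : MeasurableSet[stoppedSigma G₀ N] A)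
    (hAc : (bondPercolation (zdGraph 2) half).real Aᶜ ≤ ε₃)
    (hrep : ∀ ω ∈ A, ∀ ζ, glueAt G₀ N ω ζ ∈ E' ↔ Φ (d ω) (b (glueAt G₀ N ω ζ)))
    (hpert : ∀ ω ∈ A, ∑ i, (bondPercolation (zdGraph 2) half).real
      {ζ | ¬ (b (glueAt G₀ N ω ζ) i ↔ bT (glueAt G₀ N ω ζ) i)} ≤ ε₂)
    (hcoarse : ∃ φ : Set (Quad D) → ℝ, ∀ ω ∈ A,
      (bondPercolation (zdGraph 2) half).real {ζ | Φ (d ω) (bT (glueAt G₀ N ω ζ))} =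
        φ {Q | Q ∈ F ∧ z2QuadConfig D δ ω ∈ QuadConfig.crossedEvent Q}) :
    GluingSurrogateAt D α Q₀ F s (max ε₁ (ε₂ ^ 2 + ε₃)) δ := by
  classical
  obtain ⟨φ, hφ⟩ := hcoarse
  set P := bondPercolation (zdGraph 2) half with hP
  -- the surrogate: the coarse probability, clamped to `[0, 1]`, as a function of the bits of `F`
  set bits : BondConfig (Site 2) → Set (Quad D) := fun ω => {Q | Q ∈ F ∧ z2QuadConfig D δ ω ∈ QuadConfig.crossedEvent Q} with hbits
  set φ' : Set (Quad D) → ℝ := fun S => max 0 (min 1 (φ S)) with hφ'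
  set Z : BondConfig (Site 2) → ℝ := fun ω => φ' (bits ω) with hZ
  have hZ01 : ∀ ω, 0 ≤ Z ω ∧ Z ω ≤ 1 := fun ω =>
    ⟨le_max_left _ _, max_le zero_le_one (min_le_left _ _)⟩
  have hZm : Measurable Z :=
    measurable_comp_bits bits hF (fun ω Q hQ => hQ.1) (fun Q hQ => by
      have : {ω | Q ∈ bits ω} = z2QuadConfig D δ ⁻¹' QuadConfig.crossedEvent Q := by
        ext ω; simp [hbits, hQ]
      rw [this]; exact measurableSet_preimage_crossedEvent hδ Q) φ'
  -- on the data event, `Z` is the coarse probability and `Ỹ` the exact one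
  set Yt := stoppedCondProb (zdGraph 2) half G₀ N E' with hYt
  have hclose : ∀ ω ∈ A, |Z ω - Yt ω| ≤ ε₂ := by
    intro ω hω
    have hZω : Z ω = P.real {ζ | Φ (d ω) (bT (glueAt G₀ N ω ζ))} := by
      simp only [hZ, hφ', hbits, ← hφ ω hω]
      rw [min_eq_right measureReal_le_one, max_eq_right measureReal_nonneg]
    have hYω : Yt ω = P.real {ζ | Φ (d ω) (b (glueAt G₀ N ω ζ))} := by
      rw [hYt, stoppedCondProb_eq_real]
      congr 1
      ext ζ
      exact hrep ω hω ζ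
    rw [hZω, hYω]
    refine (abs_measureReal_sub_le_symmDiff P _ _).trans ?_
    -- the two events differ only where some bit differs
    have hsub : {ζ | Φ (d ω) (bT (glueAt G₀ N ω ζ))} ∆ {ζ | Φ (d ω) (b (glueAt G₀ N ω ζ))} ⊆
        ⋃ i ∈ (Finset.univ : Finset ι), {ζ | ¬ (b (glueAt G₀ N ω ζ) i ↔ bT (glueAt G₀ N ω ζ) i)} := by
      intro ζ hζ
      simp only [mem_iUnion, Finset.mem_univ, exists_true_left, mem_setOf_eq]
      by_contra hall
      push Not at hall
      have heq : b (glueAt G₀ N ω ζ) = bT (glueAt G₀ N ω ζ) := funext fun i => propext (hall i)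
      have h1 : (ζ ∈ {ζ | Φ (d ω) (bT (glueAt G₀ N ω ζ))}) ↔ (ζ ∈ {ζ | Φ (d ω) (b (glueAt G₀ N ω ζ))}) := by
        simp only [mem_setOf_eq, heq]
      rcases hζ with ⟨hin, hout⟩ | ⟨hin, hout⟩
      · exact hout (h1.1 hin)
      · exact hout (h1.2 hin)
    exact ((measureReal_mono hsub (measure_ne_top P _)).trans (measureReal_biUnion_finset_le _ _)).trans (hpert ω hω)
  -- everywhere, `|Z − Ỹ| ≤ 1`
  have hbound : ∀ ω, |Z ω - Yt ω| ≤ 1 := by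
    intro ω
    obtain ⟨h0, h1⟩ := hZ01 ω
    have := stoppedCondProb_nonneg (zdGraph 2) half (G₀ := G₀) (N := N) E' ω
    have := stoppedCondProb_le_one (zdGraph 2) half (G₀ := G₀) (N := N) E' ω
    rw [abs_le]; constructor <;> linarith
  -- the `L²` estimate
  have hAm : MeasurableSet A := hA.1
  have hYtm : Measurable Yt := measurable_stoppedCondProb (zdGraph 2) half hN hNG hE'
  have hint : ∫ ω, (Z ω - Yt ω) ^ 2 ∂P ≤ ε₂ ^ 2 + ε₃ := by
    have hle : ∀ ω, (Z ω - Yt ω) ^ 2 ≤ A.indicator (fun _ => ε₂ ^ 2) ω + Aᶜ.indicator (fun _ => (1 : ℝ)) ω := by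
      intro ω
      by_cases hω : ω ∈ A
      · rw [indicator_of_mem hω, indicator_of_notMem (fun h : ω ∈ Aᶜ => h hω), add_zero]
        have h := hclose ω hω
        rw [abs_le] at h
        nlinarith [h.1, h.2]
      · rw [indicator_of_notMem hω, indicator_of_mem (mem_compl hω), zero_add]
        have h := hbound ω
        rw [abs_le] at h
        nlinarith [h.1, h.2]
    have hmeas : Measurable fun ω => (Z ω - Yt ω) ^ 2 := (hZm.sub hYtm).pow_const 2
    calc ∫ ω, (Z ω - Yt ω) ^ 2 ∂P
        ≤ ∫ ω, (A.indicator (fun _ => ε₂ ^ 2) ω + Aᶜ.indicator (fun _ => (1 : ℝ)) ω) ∂P := by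
          refine integral_mono_of_nonneg (ae_of_all _ fun ω => sq_nonneg _) ?_ (ae_of_all _ hle)
          exact ((integrable_const _).indicator hAm).add ((integrable_const _).indicator hAm.compl)
      _ = ε₂ ^ 2 * P.real A + 1 * P.real Aᶜ := by
          rw [integral_add ((integrable_const _).indicator hAm) ((integrable_const _).indicator hAm.compl),
            integral_indicator_const _ hAm, integral_indicator_const _ hAm.compl, smul_eq_mul, smul_eq_mul, mul_comm, mul_comm (P.real Aᶜ)]
      _ ≤ ε₂ ^ 2 + ε₃ := by
          have h1 : P.real A ≤ 1 := measureReal_le_one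
          have h2 : 0 ≤ P.real A := measureReal_nonneg
          nlinarith [hAc, sq_nonneg ε₂]
  -- assemble the package
  refine ⟨G₀, N, E', Z, hN, hNG, hcut, hE', h44.trans (le_max_left _ _), hZm, fun ω => ?_, ?_, φ', fun ω => rfl⟩
  · obtain ⟨h0, h1⟩ := hZ01 ω
    rw [abs_le]; constructor <;> linarith
  · exact hint.trans (le_max_right _ _)

end QuadCrossing

end Literature.Probability.Percolation

end
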